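import Summits.BirchSwinnertonDyer.BirchSwinnertonDyer.Theorems.CyclotomicUntwistPSRankOneLowerHalfAtThreeOfSOEDRestricted
import Summits.BirchSwinnertonDyer.BirchSwinnertonDyer.Theorems.CyclotomicUntwistPSHalvesOfPSOntoRankZeroHalves
import HarnessLib

/-!
# K1 `PSRankOneLowerHalfAtThree` BY NAME ⟸ published inputs ∧ SOED's crux of record E′ ∧ the cheapened suppliers of the
# shared cruxes #4/#5 ∧ K2₀ — the UPPER half on the RANK-ZERO principal-series rows; NO wild rank-zero leaf

Cell `pub/bsd-wall` (D-0145 line `route-BirchSwinnertonDyer-CyclotomicUntwist`), seat `bsd-line-cycu-p4` (width seat 4,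
gen 4). Helper toward the deciding crux K1 `PSRankOneLowerHalfAtThree` (stmt-BirchSwinnertonDyer-21580). THEOREMS ONLY (no
definition, no named fact, no `sorry`); every crux / input named is an ANTECEDENT; BSD is not proved by this file and no crux is.

The K1-side twin of `CyclotomicUntwistPSRankOneUpperHalfAtThreeOfKoRankZero` (this seat: K2 ⟸ PUB ∧ Ko′ ∧ K1₀). The cross-route
kernel of record for K1 is soed-p1-w3 g6's `CyclotomicUntwistOfSOEDRestricted.lowerHalf_of_restricted_of_valueOdd_of_controlLe_of_rankZeroLeaf`:
K1 ⟸ PUB ∧ E′ (`WildSplitEisensteinInclusionAtThreeRestricted`, stmt-24155) ∧ hVodd (crux #4 at odd `d_K`) ∧ hCle (crux #5 as the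
`≤`-control) ∧ Z, where Z = `WildRankZeroTwistAtThree` = `WAllExclAddWildRankZero` (the WHOLE wild rank-zero leaf) pays the
UPPER half of a minimal model of the Heegner twist. Here that proof is taken VERBATIM with step (c) DISPLAYED
(`lowerHalf_of_restricted_of_valueOdd_of_controlLe_of_twistUpperHalf`: the twist's upper half is a hypothesis on the row, any
supply — the shape of cycu-p3 g0's `lowerHalf_row_of_eisenstein_of_waldspurger_of_control_of_twistUpperHalf`), and then fed by
**K2₀ := «∀ W globally minimal, (¬CM →) ClassO6 W 3 → Surj W 3 → v₃Δ_min even → Δ_min/3^v ≡ 1 (mod 3) → r_an = 0 →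
MissingUpperBoundAt W 3»** through cycu-p3 g0's `psOntoRow_twist_of_heegner` (the odd Heegner twist of an onto PS row is an
onto PS row of analytic rank `0`): `twistUpperHalf_of_psRankZeroUpperHalf`. By-name results (the three feeds of the
Restricted file, Z ↦ K2₀):
* **`psRankOneLowerHalfAtThree_of_restricted_of_waldspurger_of_control_of_psRankZeroUpperHalf`**: PUB ∧ E′ ∧ V ∧ C ∧ K2₀ ⟹ K1;
* `…_of_restricted_of_waldspurger_of_poitouTate_of_psRankZeroUpperHalf`: PUB ∧ E′ ∧ V ∧ PT1 ∧ K2₀ ⟹ K1;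
* `…_of_restricted_of_frameOdd_of_poitouTate_of_psRankZeroUpperHalf`: PUB ∧ E′ ∧ LZZ ∧ [frame at odd `d_K`] ∧ PT1 ∧ K2₀ ⟹ K1.
So, with this seat's K2 file: on the principal-series rows BOTH halves of the route hang on SOED's cruxes {E′ (+ #4/#5
suppliers), Ko′}, print, and the rank-ZERO PS companions {K1₀, K2₀} only — the wild rank-zero leaf (every supercuspidal /
dicyclic rank-zero row) has left the CU cone. K2₀ (the Euler-system / Kato direction at the value `L(E,1)` on rank-zero PS rows)
and K1₀ are typed together by cycu-p3 g2's `CyclotomicUntwistFiniteSlopeRankZero.rankZero_halves_of_valueFormula`.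

References: [JetchevSkinnerWan2017] Thm. 3.3.1, §7.4.1; [Castella2018] Thm. 2.3, §5; [GrossZagier1986] Thm. I.(6.3), V.§2;
[FriedbergHoffstein1995] Thm. B; [LiuZhangZhang2018] Thm 1.5.1/1.5.3; [MilneADT2006] I Thm. 4.10(b); [Miller2011LMS] Def. 1.1;
[SilvermanAEC2009] X.5 Cor. 5.4; [Zywina2015] Prop. 1.14/1.16.
-/

noncomputable section

open scoped Classical

-- single-conjunct summit: `Summit.BirchSwinnertonDyer.BirchSwinnertonDyer.…` repeats the name by design
set_option linter.dupNamespace false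
set_option autoImplicit false

namespace Summit.BirchSwinnertonDyer.BirchSwinnertonDyer.Theorems.PSLowerHalfOfRestrictedRankZero

open WeierstrassCurve NumberField IsDedekindDomain Field
  Literature.NumberTheory.EllipticCurves
  Literature.NumberTheory.EllipticCurves.ModularForms
  Literature.NumberTheory.EllipticCurves.LiuZhangZhang2018
  Literature.NumberTheory.EllipticCurves.Rank1Residual
  Literature.NumberTheory.EllipticCurves.Rank1Residual.Typed
  Literature.NumberTheory.EllipticCurves.KrizLi2019
  Summit.BirchSwinnertonDyer.Rank1Residual
  Summit.BirchSwinnertonDyer.Rank1Residual.Additive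
  Summit.BirchSwinnertonDyer.Rank1Residual.X11b
  Summit.BirchSwinnertonDyer.Rank1Residual.X11b.AcSelmer
  Summit.BirchSwinnertonDyer.Rank1Residual.X11b.Halves
  Summit.BirchSwinnertonDyer.BirchSwinnertonDyer.Theses.SemiOrdinaryEisensteinDescent
  Summit.BirchSwinnertonDyer.BirchSwinnertonDyer.Theorems
  Summit.BirchSwinnertonDyer.BirchSwinnertonDyer.Theorems.CyclotomicUntwistOfSOED
  Summit.BirchSwinnertonDyer.BirchSwinnertonDyer.Theorems.EisensteinKernelAtThreeRestrictedOfControlLe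

/-! ### §1 CORE with the twist's UPPER half displayed (soed-p1-w3 g6's §1 verbatim, step (c) a hypothesis) -/

/-- **The Iwasawa-side LOWER half on an onto wild rank-one row ⟸ PUB ∧ E′ ∧ hVodd ∧ hCle ∧ «the UPPER half of every
globally minimal model of every odd Heegner twist of THAT row»** (any supply). Steps (a)–(b) and the joint descent are
`CyclotomicUntwistOfSOEDRestricted.lowerHalf_of_restricted_of_valueOdd_of_controlLe_of_rankZeroLeaf` VERBATIM (parity;
Friedberg–Hoffstein with modulus `2`; Heegner point, Gross–Zagier, Kolyvagin; frame; value from `hVodd`; `≤`-control from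
`hCle`; E′ BY NAME; `≤`-link ⟹ STEP L; JOINT lower half; descend) — only the twist's upper half is now DISPLAYED instead of
being paid by the wild rank-zero leaf. CONDITIONAL; closes nothing; BSD is not proved by this.
[cite: JetchevSkinnerWan2017, Thm. 3.3.1 and §7.4.1 (arXiv:1512.06894 pp. 11, 30)] [cite: Castella2018, Thm. 2.3 and §5 (5.1)–(5.3)]
[cite: GrossZagier1986, Thm. I.(6.3) and V.§2] [cite: FriedbergHoffstein1995, Thm. B] [cite: Miller2011LMS, Def. 1.1 (arXiv:1010.2431 p. 3)] -/
theorem lowerHalf_of_restricted_of_valueOdd_of_controlLe_of_twistUpperHalf (hF : PublishedInputsWildThree)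
    (hE' : WildSplitEisensteinInclusionAtThreeRestricted)
    (hVodd : ∀ (W : WeierstrassCurve ℚ) [W.IsElliptic] [W.IsGloballyMinimal] (N : ℕ) [NeZero N] (K : Type) [Field K] [NumberField K] (Dt : Literature.NumberTheory.EllipticCurves.ModularForms.ModularParametrizationData W N) (H : Literature.NumberTheory.EllipticCurves.HeegnerDatum N (NumberField.discr K)) (ι : K →+* ℂ) (P : (W.baseChange K).toAffine.Point), Summit.BirchSwinnertonDyer.Rank1Residual.Additive.ClassO6 W 3 → W.HasSurjectiveModNGaloisRep 3 → W.analyticRank = 1 → W.conductorNorm ℤ = N → Literature.NumberTheory.EllipticCurves.IsImaginaryQuadratic K → Literature.NumberTheory.EllipticCurves.SatisfiesHeegnerHypothesis N K → Odd (NumberField.discr K) → (W.quadraticTwist (NumberField.discr K : ℚ)).entireLFunction 1 ≠ 0 → (WeierstrassCurve.Affine.Point.map ι.toRatAlgHom) P = Literature.NumberTheory.EllipticCurves.ModularForms.heegnerPointComplex Dt H → ¬ IsOfFinAddOrder P → ∀ (κ : Literature.NumberTheory.EllipticCurves.ZpExtension K 3), κ.IsAnticyclotomic → ∀ (γ : Field.absoluteGaloisGroup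 K) [Fact (κ.IsTopGenerator γ)] (𝔭 : IsDedekindDomain.HeightOneSpectrum (NumberField.RingOfIntegers K)) (h𝔭 : ((3 : ℕ) : NumberField.RingOfIntegers K) ∈ 𝔭.asIdeal) (he : 𝔭.asIdeal.ramificationIdx (NumberField.RingOfIntegers ℚ) = 1) (hf : 𝔭.asIdeal.inertiaDeg (NumberField.RingOfIntegers ℚ) = 1), ∃ ι' : PadicAlgCl 3 ≃+* ℂ, Summit.BirchSwinnertonDyer.BirchSwinnertonDyer.Theorems.SchneiderFree.BranchInducesPrime 3 ι' 𝔭 ∧ ∃ (ΩK : ℂ) (Ωp : ℂ_[3]) (L : Literature.NumberTheory.EllipticCurves.UnrSeries 3), ΩK ≠ 0 ∧ Ωp ≠ 0 ∧ Literature.NumberTheory.EllipticCurves.IsBDPLFunction ι' 𝔭 κ γ Dt.f ΩK Ωp L ∧ ∃ u : (Literature.NumberTheory.EllipticCurves.unrIntegers 3)ˣ, L.HasValueAt 0 ((((u : Literature.NumberTheory.EllipticCurves.unrIntegers 3) : Literature.NumberTheory.EllipticCurves.unrIntegers 3) : ℂ_[3]) * (algebraMap ℚ_[3] ℂ_[3]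 (Summit.BirchSwinnertonDyer.Rank1Residual.X11b.Halves.logOmega W 3 (Summit.BirchSwinnertonDyer.Rank1Residual.X11b.embAt K 3 𝔭 h𝔭 he hf) P / (Dt.c : ℚ_[3]))) ^ 2))
    (hCle : ∀ (W : WeierstrassCurve ℚ) [W.IsElliptic] [W.IsGloballyMinimal] (N : ℕ) [NeZero N] (K : Type) [Field K] [NumberField K] (Dt : Literature.NumberTheory.EllipticCurves.ModularForms.ModularParametrizationData W N) (H : Literature.NumberTheory.EllipticCurves.HeegnerDatum N (NumberField.discr K)) (ι : K →+* ℂ) (P : (W.baseChange K).toAffine.Point), Summit.BirchSwinnertonDyer.Rank1Residual.Additive.ClassO6 W 3 → W.HasSurjectiveModNGaloisRep 3 → W.analyticRank = 1 → W.conductorNorm ℤ = N → Literature.NumberTheory.EllipticCurves.IsImaginaryQuadratic K → Literature.NumberTheory.EllipticCurves.SatisfiesHeegnerHypothesis N K → (W.quadraticTwist (NumberField.discr K : ℚ)).entireLFunction 1 ≠ 0 → (WeierstrassCurve.Affine.Point.map ι.toRatAlgHom) P = Literature.NumberTheory.EllipticCurves.ModularForms.heegnerPointComplex Dt H → ¬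 IsOfFinAddOrder P → Literature.NumberTheory.EllipticCurves.kolyvagin N W K → ∀ (κ : Literature.NumberTheory.EllipticCurves.ZpExtension K 3), κ.IsAnticyclotomic → ∀ (γ : Field.absoluteGaloisGroup K) [Fact (κ.IsTopGenerator γ)] (𝔭 : IsDedekindDomain.HeightOneSpectrum (NumberField.RingOfIntegers K)) (h𝔭 : ((3 : ℕ) : NumberField.RingOfIntegers K) ∈ 𝔭.asIdeal) (he : 𝔭.asIdeal.ramificationIdx (NumberField.RingOfIntegers ℚ) = 1) (hf : 𝔭.asIdeal.inertiaDeg (NumberField.RingOfIntegers ℚ) = 1), Summit.BirchSwinnertonDyer.BirchSwinnertonDyer.Theorems.SchneiderFreeControlAtoms.AdditiveControlLeOnTreeAt 3 κ 𝔭 γ (Summit.BirchSwinnertonDyer.Rank1Residual.X11b.embAt K 3 𝔭 h𝔭 he hf) 0 P)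
    (W : WeierstrassCurve ℚ) [W.IsElliptic] [W.IsGloballyMinimal]
    (hO6 : ClassO6 W 3) (hsurj : W.HasSurjectiveModNGaloisRep 3) (hr : W.analyticRank = 1)
    (hTwUp : ∀ (K : Type) [Field K] [NumberField K] (Wd : WeierstrassCurve ℚ) [Wd.IsElliptic] [Wd.IsGloballyMinimal]
      (Cd : VariableChange ℚ), IsImaginaryQuadratic K → Odd (NumberField.discr K) →
      SatisfiesHeegnerHypothesis (W.conductorNorm ℤ) K →
      (W.quadraticTwist (NumberField.discr K : ℚ)).entireLFunction 1 ≠ 0 →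
      Cd • W.quadraticTwist (NumberField.discr K : ℚ) = Wd → MissingUpperBoundAt Wd 3) :
    MissingLowerBoundAt W 3 := by
  obtain ⟨hGZ, hKo, hGZK, hmod, -, -, hGZ73, hFH, hpar, hHP⟩ := hF
  haveI hN0 : NeZero (W.conductorNorm ℤ) := ⟨W.conductorNorm_pos_holds.ne'⟩
  -- (a) DATA. parity: `r_an = 1` is odd, so `w(E) = -1`
  have hw : W.rootNumber = -1 := by
    rcases W.rootNumber_eq_one_or with h | h
    · exfalso
      have heven : Even W.analyticRank := (hpar W).mpr h
      rw [hr] at heven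
      exact Nat.not_even_one heven
    · exact h
  -- Friedberg–Hoffstein with auxiliary modulus `2`: Heegner for `N(E)` and `2` split (so `d_K` is odd)
  obtain ⟨K, _, _, hK, -, hHN, hH2, hLt⟩ := hFH W hw 2 two_ne_zero 0
  have hodd : Odd (NumberField.discr K) := by
    have h8 := Literature.SatisfiesHeegnerHypothesis.discr_emod_eight hK.1 hH2 (dvd_refl 2)
    rw [Int.odd_iff]; omega
  -- `3 ∣ N(E)` (additive) splits in `K`; hence `3 ∤ #𝓞_K^×`
  have h3N : 3 ∣ W.conductorNorm ℤ :=
    (W.dvd_conductorNorm_iff_not_hasGoodReductionAtPrime 3).mpr (not_good_of_addv W 3 hO6.2.1)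
  have hsplit : SplitsIn K 3 := hHN 3 Nat.prime_three h3N
  have hwK : ¬ 3 ∣ Units.torsionOrder K :=
    (X11b.Three.not_dvd_discr_and_not_dvd_torsionOrder_of_heegner hK hHN (by decide) h3N).2
  -- the Heegner point over `K` and its data; non-torsion by Gross–Zagier
  obtain ⟨P, Dt, H, ι, hP⟩ := hHP W K hK hHN
  have hL0 : W.entireLFunction 1 = 0 := entireLFunction_one_eq_zero_of_analyticRank_eq_one hr
  obtain ⟨-, hderiv⟩ := leadingLCoeff_eq_deriv_of_analyticRank_eq_one hr
  have hLK : LDerivEK W K ≠ 0 := by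
    rw [lDerivEK_eq_deriv_mul W K hmod hL0]; exact mul_ne_zero hderiv hLt
  have hnt : ¬ IsOfFinAddOrder P :=
    (lDerivEK_ne_zero_iff_not_isOfFinAddOrder W (W.conductorNorm ℤ) K (hGZ _ W K) hK hHN
      ⟨Dt, H, ι, hP⟩).mp hLK
  -- Kolyvagin: `rank E(K) = 1`, `Ш(E/K)` finite
  obtain ⟨hrk, hfin⟩ := hKo (W.conductorNorm ℤ) W K hK hHN ⟨Dt, H, ι, hP⟩ hnt
  -- a frame `(κ, γ, 𝔭)` and the other prime `𝔭′ ≠ 𝔭` above `3`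
  obtain ⟨κ, γ, -, hκ, hγ, -⟩ := X11b.exists_anticyclotomic_generator_prime (p := 3) hK
  haveI : Fact (κ.IsTopGenerator γ) := ⟨hγ⟩
  obtain ⟨𝔭, h𝔭, he, hf⟩ := X11b.exists_degreeOnePrime_of_splitsIn K 3 hK.1 hsplit
  obtain ⟨𝔭', hne, h𝔭', he', hf'⟩ := X11b.Three.exists_ne_degreeOne_prime hK.1 h𝔭 he hf
  -- (b) PLUMBING. frame AND unit value at `(κ, γ, 𝔭)` over the Friedberg–Hoffstein field (odd `d_K`), from `hVodd`
  obtain ⟨ι', hind, ΩK, Ωp, L, hΩK, hΩp, hBDP, u, hval⟩ :=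
    hVodd W (W.conductorNorm ℤ) K Dt H ι P hO6 hsurj hr rfl hK hHN hodd hLt hP hnt κ hκ γ 𝔭 h𝔭 he hf
  -- the control INEQUALITY at `𝔭′` at slack `0` (CTL₀ included), from `hCle`
  have hctl : SchneiderFreeControlAtoms.AdditiveControlLeOnTreeAt 3 κ 𝔭' γ (embAt K 3 𝔭' h𝔭' he' hf') 0 P :=
    hCle W (W.conductorNorm ℤ) K Dt H ι P hO6 hsurj hr rfl hK hHN hLt hP hnt (hKo _ W K) κ hκ γ 𝔭'
      h𝔭' he' hf'
  obtain ⟨n, hn, hnle⟩ := hctl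
  -- the RESTRICTED EISENSTEIN INCLUSION `Ch_Λ(X_(∅,0))·R₀⟦T⟧ ⊆ (L)` at the frame (crux #2′ BY NAME, fed with the datum,
  -- torsion-guarded by CTL₀)
  have hincl : (XAc.charIdeal (W.baseChange K) 3 κ 𝔭' ∅ γ).map (PowerSeries.map (toUnr 3)) ≤
      Ideal.span {L} :=
    hE' W (W.conductorNorm ℤ) K Dt H ι P hO6 hsurj hr rfl hK hHN hLt hP hnt κ hκ γ 𝔭 h𝔭 he hf 𝔭' h𝔭' hne ι' hind
      ΩK Ωp L hΩK hΩp hBDP hn.1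
  -- the value read through the logarithm at `𝔭′` (rank one: `(log_{𝔭′} P)² = (log_𝔭 P)²`)
  have hval' : L.HasValueAt 0 ((((u : unrIntegers 3) : unrIntegers 3) : ℂ_[3]) *
      (algebraMap ℚ_[3] ℂ_[3]
        (logOmega W 3 (embAt K 3 𝔭' h𝔭' he' hf') P / (Dt.c : ℚ_[3]))) ^ 2) :=
    (SchneiderFreeAdditiveX3.hasValueAt_sq_logOmega_embAt_iff_of_rank_one W 3 hK.1 hrk h𝔭 he hf
      h𝔭' he' hf' P _ _ L).mpr hval
  -- the LOWER socket at slack `v₃(c)` at the frame `(κ, 𝔭′, γ, embAt 𝔭′)`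
  have hc0 : Dt.c ≠ 0 := Dt.maninConstant_ne_zero_holds
  have hlog : logOmega W 3 (embAt K 3 𝔭' h𝔭' he' hf') P ≠ 0 := X11b.R1.logOmega_ne_zero W 3 _ hnt
  have hlow : SchneiderFree.AdditiveIMCLowerBDPOnTreeLeAt 3 κ 𝔭' γ (embAt K 3 𝔭' h𝔭' he' hf')
      (padicValNat 3 Dt.c.natAbs) P := by
    -- the LOWER norm receptacle (`⊆` + value): `2·ord₃(log_{𝔭′}P / c) ≤ ord₃ f(0)`
    obtain ⟨htors, f, hfI, hf0, hfn⟩ := hn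
    have hmem : PowerSeries.map (toUnr 3) f ∈ Ideal.span {L} := by
      have h3 := hincl
      rw [hfI, CongruenceLimit.map_span_singleton_powerSeries] at h3
      exact (Ideal.span_singleton_le_iff_mem _).mp h3
    obtain ⟨-, hle⟩ := Supersingular.two_mul_valuation_le_of_mem_span 3 hf0 hmem u hval'
    have hc0' : (Dt.c : ℚ_[3]) ≠ 0 := by exact_mod_cast hc0
    rw [div_eq_mul_inv, Padic.valuation_mul hlog (inv_ne_zero hc0'), Padic.valuation_inv,
      Padic.valuation_intCast, valuation_logOmega hlog, hfn] at hle
    refine ⟨n, ⟨htors, f, hfI, hf0, hfn⟩, ?_⟩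
    simp only [padicValInt] at hle
    linarith
  -- STEP L at slack `v₃(c)`: the link consumes control ONLY as `≤` (utd-p3 g6, p593079 §3)
  have hlo : SchneiderFree.IndexLowerBoundLeAt W 3 K P (padicValNat 3 Dt.c.natAbs) :=
    AdditiveRankOneControlLe.indexLowerBoundLeAt_of_imcLowerLe_of_controlLe_zero rfl hK hHN hfin hlow
      ⟨n, hn, hnle⟩
  -- (c) a globally minimal model of the twist; its UPPER half from the DISPLAYED hypothesis `hTwUp`
  have hD0 : (NumberField.discr K : ℚ) ≠ 0 := by exact_mod_cast NumberField.discr_ne_zero K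
  haveI : (W.quadraticTwist (NumberField.discr K : ℚ)).IsElliptic := W.isElliptic_quadraticTwist hD0
  obtain ⟨Cd, hCd⟩ := hasGlobalMinimalModel_rat_holds (W.quadraticTwist (NumberField.discr K : ℚ))
  haveI : (Cd • W.quadraticTwist (NumberField.discr K : ℚ)).IsGloballyMinimal := hCd
  have hdup : MissingUpperBoundAt (Cd • W.quadraticTwist (NumberField.discr K : ℚ)) 3 :=
    hTwUp K (Cd • W.quadraticTwist (NumberField.discr K : ℚ)) Cd hK hodd hHN hLt rfl
  -- JOINT lower half over the pair, then descend with the twist's upper half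
  exact missingLowerBoundAt_of_joint_of_upper
    (SchneiderFree.Exact.jointLowerBoundAt_of_stepL_manin hGZ hKo hGZK hmod hGZ73 W 3 (W.conductorNorm ℤ)
      K Dt H ι P (Cd • W.quadraticTwist (NumberField.discr K : ℚ)) hr rfl h3N hK hodd hwK hHN hLt hP
      ⟨Cd, rfl⟩ (by decide) hlo) hdup


/-! ### §2 The displayed hypothesis from K2₀ (the UPPER half on the rank-ZERO principal-series rows), and K1 BY NAME -/

/-- **K2₀ ⟹ the twist's upper half on every PS row**: the odd Heegner twist of an onto PS row is an onto PS row of analytic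
rank `0` (`CyclotomicUntwistOfSOED.psOntoRow_twist_of_heegner`), where K2₀ applies. [cite: SilvermanAEC2009, X.5 Cor. 5.4]
[cite: Zywina2015, Prop. 1.14 and Prop. 1.16 (§1.9)] -/
theorem twistUpperHalf_of_psRankZeroUpperHalf
    (hU0 : ∀ (Wd : WeierstrassCurve ℚ) [Wd.IsElliptic] [Wd.IsGloballyMinimal],
      ¬ Wd.HasCM → ClassO6 Wd 3 → Surj Wd 3 →
      Even (padicValInt 3 Wd.minimalDiscriminantInt) →
      Wd.minimalDiscriminantInt / 3 ^ padicValInt 3 Wd.minimalDiscriminantInt % 3 = 1 →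
      Wd.analyticRank = 0 → MissingUpperBoundAt Wd 3)
    (W : WeierstrassCurve ℚ) [W.IsElliptic] [W.IsGloballyMinimal]
    (hO6 : ClassO6 W 3) (hsurj : W.HasSurjectiveModNGaloisRep 3)
    (hev : Even (padicValInt 3 W.minimalDiscriminantInt))
    (hsq : W.minimalDiscriminantInt / 3 ^ padicValInt 3 W.minimalDiscriminantInt % 3 = 1) :
    ∀ (K : Type) [Field K] [NumberField K] (Wd : WeierstrassCurve ℚ) [Wd.IsElliptic] [Wd.IsGloballyMinimal]
      (Cd : VariableChange ℚ), IsImaginaryQuadratic K → Odd (NumberField.discr K) →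
      SatisfiesHeegnerHypothesis (W.conductorNorm ℤ) K →
      (W.quadraticTwist (NumberField.discr K : ℚ)).entireLFunction 1 ≠ 0 →
      Cd • W.quadraticTwist (NumberField.discr K : ℚ) = Wd → MissingUpperBoundAt Wd 3 := by
  intro K _ _ Wd _ _ Cd hK hodd hHN hLt hCd
  obtain ⟨hCMd, hO6d, hsurjd, hevd, hsqd, hrd, -⟩ :=
    psOntoRow_twist_of_heegner W hO6 hsurj hev hsq K hK hodd hHN hLt Wd Cd hCd
  exact hU0 Wd hCMd hO6d hsurjd hevd hsqd hrd

/-- **K1 `PSRankOneLowerHalfAtThree` (21580) ⟸ PUB ∧ E′ (24155) ∧ V (20385) ∧ C (20386) ∧ K2₀** — soed-p1-w3 g6's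
`psRankOneLowerHalfAtThree_of_restricted_of_waldspurger_of_control` with the wild rank-zero leaf Z REPLACED by the upper half
on the rank-zero PS rows (feeds `valueOdd_of_waldspurger`, `controlLe_of_control` of p595286). CONDITIONAL cross-route kernel;
closes nothing; BSD is not proved by this. [cite: JetchevSkinnerWan2017, §7.4.1 (arXiv:1512.06894 p. 30)] [cite: SilvermanAEC2009, X.5 Cor. 5.4] -/
theorem psRankOneLowerHalfAtThree_of_restricted_of_waldspurger_of_control_of_psRankZeroUpperHalf
    (hF : PublishedInputsWildThree) (hE' : WildSplitEisensteinInclusionAtThreeRestricted) (hV : WildSplitWaldspurgerAtThree)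
    (hC : WildSplitControlAtThree)
    (hU0 : ∀ (Wd : WeierstrassCurve ℚ) [Wd.IsElliptic] [Wd.IsGloballyMinimal],
      ¬ Wd.HasCM → ClassO6 Wd 3 → Surj Wd 3 →
      Even (padicValInt 3 Wd.minimalDiscriminantInt) →
      Wd.minimalDiscriminantInt / 3 ^ padicValInt 3 Wd.minimalDiscriminantInt % 3 = 1 →
      Wd.analyticRank = 0 → MissingUpperBoundAt Wd 3) :
    Summit.BirchSwinnertonDyer.BirchSwinnertonDyer.Theses.CyclotomicUntwist.PSRankOneLowerHalfAtThree := by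
  intro W _ _ _hncm hO6 hsurj hev hsq hr
  exact lowerHalf_of_restricted_of_valueOdd_of_controlLe_of_twistUpperHalf hF hE' (valueOdd_of_waldspurger hV)
    (controlLe_of_control hC) W hO6 hsurj hr (twistUpperHalf_of_psRankZeroUpperHalf hU0 W hO6 hsurj hev hsq)

/-- **K1 ⟸ PUB ∧ E′ ∧ V ∧ PT1 ∧ K2₀** — crux #5 replaced by Poitou–Tate duality for Selmer structures alone (feed
`controlLe_of_poitouTate`), Z by K2₀. CONDITIONAL; closes nothing. [cite: MilneADT2006, Ch. I, Thm. 4.10(b)]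
[cite: JetchevSkinnerWan2017, Thm. 3.3.1 and §7.4.1 (arXiv:1512.06894 pp. 11, 30)] -/
theorem psRankOneLowerHalfAtThree_of_restricted_of_waldspurger_of_poitouTate_of_psRankZeroUpperHalf
    (hF : PublishedInputsWildThree) (hE' : WildSplitEisensteinInclusionAtThreeRestricted) (hV : WildSplitWaldspurgerAtThree)
    (hPT : ∀ (K : Type) [Field K] [NumberField K], Literature.NumberTheory.GaloisCohomology.poitouTate_selmerStructure_duality K)
    (hU0 : ∀ (Wd : WeierstrassCurve ℚ) [Wd.IsElliptic] [Wd.IsGloballyMinimal],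
      ¬ Wd.HasCM → ClassO6 Wd 3 → Surj Wd 3 →
      Even (padicValInt 3 Wd.minimalDiscriminantInt) →
      Wd.minimalDiscriminantInt / 3 ^ padicValInt 3 Wd.minimalDiscriminantInt % 3 = 1 →
      Wd.analyticRank = 0 → MissingUpperBoundAt Wd 3) :
    Summit.BirchSwinnertonDyer.BirchSwinnertonDyer.Theses.CyclotomicUntwist.PSRankOneLowerHalfAtThree := by
  intro W _ _ _hncm hO6 hsurj hev hsq hr
  exact lowerHalf_of_restricted_of_valueOdd_of_controlLe_of_twistUpperHalf hF hE' (valueOdd_of_waldspurger hV)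
    (controlLe_of_poitouTate hPT) W hO6 hsurj hr (twistUpperHalf_of_psRankZeroUpperHalf hU0 W hO6 hsurj hev hsq)

/-- **K1 ⟸ PUB ∧ E′ ∧ LZZ ∧ [one `R₀`-frame at odd `d_K`] ∧ PT1 ∧ K2₀** — both shared cruxes #4/#5 replaced by their cheap
suppliers (feeds `valueOdd_of_lzz_of_frameOdd`, `controlLe_of_poitouTate`), Z by K2₀: on the principal-series rows CU's K1 hangs
on the research set {E′, K2₀} + {frame at odd d_K (print + port)} + refereed facts. CONDITIONAL; closes nothing; BSD is not
proved by this. [cite: JetchevSkinnerWan2017, §7.4.1 (arXiv:1512.06894 p. 30)] [cite: LiuZhangZhang2018, Thm 1.5.1 and Thm 1.5.3]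
[cite: MilneADT2006, Ch. I, Thm. 4.10(b)] -/
theorem psRankOneLowerHalfAtThree_of_restricted_of_frameOdd_of_poitouTate_of_psRankZeroUpperHalf
    (hF : PublishedInputsWildThree) (hE' : WildSplitEisensteinInclusionAtThreeRestricted)
    (hLZZ : thm151_thm153_modularCurve_heegnerVector_additive)
    (hFr : ∀ (W : WeierstrassCurve ℚ) [W.IsElliptic] [W.IsGloballyMinimal] (N : ℕ) [NeZero N] (K : Type) [Field K] [NumberField K] (Dt : Literature.NumberTheory.EllipticCurves.ModularForms.ModularParametrizationData W N), Summit.BirchSwinnertonDyer.Rank1Residual.Additive.ClassO6 W 3 → W.conductorNorm ℤ = N → Literature.NumberTheory.EllipticCurves.IsImaginaryQuadratic K → Literature.NumberTheory.EllipticCurves.SatisfiesHeegnerHypothesis N K → Odd (NumberField.discr K) → ∀ (κ : Literature.NumberTheory.EllipticCurves.ZpExtension K 3), κ.IsAnticyclotomic → ∀ (γ : Field.absoluteGaloisGroup K) [Fact (κ.IsTopGenerator γ)] (𝔭 : IsDedekindDomain.HeightOneSpectrum (NumberField.RingOfIntegers K)), ((3 : ℕ) : NumberField.RingOfIntegers K)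 ∈ 𝔭.asIdeal → ∃ ι' : PadicAlgCl 3 ≃+* ℂ, Summit.BirchSwinnertonDyer.BirchSwinnertonDyer.Theorems.SchneiderFree.BranchInducesPrime 3 ι' 𝔭 ∧ ∃ (ΩK : ℂ) (Ωp : ℂ_[3]) (L : Literature.NumberTheory.EllipticCurves.UnrSeries 3), ΩK ≠ 0 ∧ Ωp ≠ 0 ∧ Literature.NumberTheory.EllipticCurves.IsBDPLFunction ι' 𝔭 κ γ Dt.f ΩK Ωp L)
    (hPT : ∀ (K : Type) [Field K] [NumberField K], Literature.NumberTheory.GaloisCohomology.poitouTate_selmerStructure_duality K)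
    (hU0 : ∀ (Wd : WeierstrassCurve ℚ) [Wd.IsElliptic] [Wd.IsGloballyMinimal],
      ¬ Wd.HasCM → ClassO6 Wd 3 → Surj Wd 3 →
      Even (padicValInt 3 Wd.minimalDiscriminantInt) →
      Wd.minimalDiscriminantInt / 3 ^ padicValInt 3 Wd.minimalDiscriminantInt % 3 = 1 →
      Wd.analyticRank = 0 → MissingUpperBoundAt Wd 3) :
    Summit.BirchSwinnertonDyer.BirchSwinnertonDyer.Theses.CyclotomicUntwist.PSRankOneLowerHalfAtThree := by
  intro W _ _ _hncm hO6 hsurj hev hsq hr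
  exact lowerHalf_of_restricted_of_valueOdd_of_controlLe_of_twistUpperHalf hF hE' (valueOdd_of_lzz_of_frameOdd hLZZ hFr)
    (controlLe_of_poitouTate hPT) W hO6 hsurj hr (twistUpperHalf_of_psRankZeroUpperHalf hU0 W hO6 hsurj hev hsq)

end Summit.BirchSwinnertonDyer.BirchSwinnertonDyer.Theorems.PSLowerHalfOfRestrictedRankZero

end
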